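import Summits.HodgeConjecture.HodgeConjecture.Theorems.Ring2WeilCoverageWeilGramLevel84SqrtNegOneGram
import Summits.HodgeConjecture.HodgeConjecture.Theorems.Ring2WeilCoverageWeilGramLevel84SqrtNegThreeGram
import Summits.HodgeConjecture.HodgeConjecture.Theorems.Ring2WeilCoverageWeilGramLevel84SqrtNegSevenGram
import Summits.HodgeConjecture.HodgeConjecture.Theorems.Ring2WeilCoverageWeilGramLevel84SqrtNegTwentyOneGram
import Summits.HodgeConjecture.HodgeConjecture.Theorems.Ring2WeilCoverageWeilGramSign
import Summits.HodgeConjecture.HodgeConjecture.Theorems.Ring2WeilCoverageCyclotomicSignaturesG12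
import Summits.HodgeConjecture.HodgeConjecture.Theorems.Ring2WeilCoverageRealUnitNormTwelve
import HarnessLib

/-!
# Weil-type family coverage — THE COMPONENTS OF THE WEIL-TYPE `ℤ[ζ₈₄]`-TWELVEFOLDS, VI: `θ^i` (`i < 12`) is a `ℚ`-basis of
# `ℚ(ζ₈₄)⁺`; for each of the 4 imaginary quadratic `K_d ⊂ ℚ(ζ₈₄)` EVERY principal-type `E_ζ′` has the Gram determinant
# of §1 of parts 178–181 (`ℚ(i)`: `4096`; `ℚ(√−3)`: `2985984`; `ℚ(√−7)`: `481890304`; `ℚ(√−21)`: `351298031616`) — all of the RIGHT sign and in the SPLIT class: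
# **the principally polarised Weil-type `ℤ[ζ₈₄]`-CM twelvefolds lie on the SPLIT rows `W12.d.1`, for every `K_d`-balanced CM type**

research route conditional on HC_CM; not a corollary; Q11.4-sentence-2 already refuted in dim ≥ 3.

Ring 2, WEIL-TYPE FAMILY-COVERAGE CENSUS (`HOME/WEIL-FAMILY-COVERAGE.md` `## b01`, blocks b01.36 (D) (the YES rows at `84`),
b01.47–b01.49; owner ring2-b01), part 182 of the `Ring2WeilCoverage*` series; continues parts 178–181 (traces,
Hankel matrices, determinants).
At the level `M = 84` (`g = 12`, `h(ℚ(ζ₈₄)) = 1`) EVERY census row `(84, K_d)` is a YES row (an `ι`-compatible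
PRINCIPAL polarisation exists on every `K_d`-balanced `ℂ^Φ/Φ(ℤ[ζ₈₄])`, b01.36 / parts 14–22); this series computes, for each
`K_d ⊂ ℚ(ζ₈₄)`, van Geemen's Gram determinant of the principal type in the real frame `θ^i` and places these CM points on
their component: the SPLIT row `W12.d.1` — completing the census's component column at every `h = 1` level (b01.47–b01.49
did `15, 16, 20, 24 / 21, 28, 36 / 33, 44 / 35, 45`).

* §2 `[ℚ(ζ₈₄)⁺ : ℚ] = 12` and **`1, θ, …, θ¹¹` is a `ℚ`-basis of `ℚ(ζ₈₄)⁺`** (a relation traced against `ξ s θ^m` lies in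
  the kernel of the non-singular Gram matrix).
* `K_d = ℚ(i)` (`s = √−1 = ζ²¹ = i`): **EVERY principal-type `ζ′` gives `det a = 4096`** (`N(u) = 1` by THEOREM L (i) at `84`, `norm_realUnits_pos_eightyFour`); such `Φ`-positive `ζ′` exist on every `ℚ(i)`-balanced `Φ` (`exists_principal_eightyFour_sqrt_neg_one`) — CENSUS FORM; class **`[4096] = [64² + 1·0²] = splitDiscriminantClass 6 1`**, SPLIT: row W12.1.1 `= (6, ℚ(i), 1)`.
* `K_d = ℚ(√−3)` (`s = √−3 = 1 + 2ζ²⁸ (ζ₃ = ζ²⁸)`): **EVERY principal-type `ζ′` gives `det a = 2985984`** (`N(u) = 1` by THEOREM L (i) at `84`, `norm_realUnits_pos_eightyFour`); such `Φ`-positive `ζ′` exist on every `ℚ(√−3)`-balanced `Φ` (`exists_principal_eightyFour_sqrt_neg_three`) — CENSUS FORM; class **`[2985984] = [1728² + 3·0²] = splitDiscriminantClass 6 3`**, SPLIT: row W12.3.1 `= (6, ℚ(√−3), 1)`.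
* `K_d = ℚ(√−7)` (`s = √−7 = 1 + 2(ζ¹² + ζ²⁴ + ζ⁴⁸) (Gauss sum of ζ₇ = ζ¹²)`): **EVERY principal-type `ζ′` gives `det a = 481890304`** (`N(u) = 1` by THEOREM L (i) at `84`, `norm_realUnits_pos_eightyFour`); such `Φ`-positive `ζ′` exist on every `ℚ(√−7)`-balanced `Φ` (`exists_principal_eightyFour_sqrt_neg_seven`) — CENSUS FORM; class **`[481890304] = [21952² + 7·0²] = splitDiscriminantClass 6 7`**, SPLIT: row W12.7.1 `= (6, ℚ(√−7), 1)`.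
* `K_d = ℚ(√−21)` (`s = −√−21 = ζ²¹(1 + 2ζ²⁸)(1 + 2(ζ¹² + ζ²⁴ + ζ⁴⁸)) = i·√−3·√−7`): **EVERY principal-type `ζ′` gives `det a = 351298031616`** (`N(u) = 1` by THEOREM L (i) at `84`, `norm_realUnits_pos_eightyFour`); such `Φ`-positive `ζ′` exist on every `ℚ(√−21)`-balanced `Φ` (`exists_principal_eightyFour_sqrt_neg_twentyOne`) — CENSUS FORM; class **`[351298031616] = [592704² + 21·0²] = splitDiscriminantClass 6 21`**, SPLIT: row W12.21.1 `= (6, ℚ(√−21), 1)`.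

HONEST FRAMING as parts 82–154: kernel statements about traces in `ℚ(ζ₈₄)`, Shimura's divisors of principal type on
`ℂ^Φ/Φ(ℤ[ζ₈₄])` and norm classes; the census ROW words are the reading of the class `[det a]` by [vG94 Lemma 5.2 (3),
(5.4.1)]; nothing about Hodge classes, `W_K`, general members or HC; `HC_CM` is used nowhere.  No `def`, no named fact,
no `sorry`.

References: [cite: vanGeemen1994HodgeAV, Lemma 5.2 (2)–(4), 5.4 and (5.4.1)]; [cite: Shimura1998, §14.3 Prop. 4–5,
pp. 103–104]; census b01.36 (D), b01.47–b01.49 (seat-derived).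
-/

noncomputable section

open Polynomial NumberField Module
open scoped nonZeroDivisors

namespace Summit.HodgeConjecture.Ring2WeilCoverage.WeilGramLevel84Principal

open Literature.AlgebraicGeometry.VanGeemen1994 (weilField weilNormResidueGroup)
open Literature.AlgebraicGeometry.Motives (CMType normUnitsSubgroup)
open Literature.NumberTheory.ComplexMultiplication
open Summit.HodgeConjecture.Ring2WeilCoverage.WeilGramTools
open Summit.HodgeConjecture.Ring2WeilCoverage.WeilGramCMPoint
open Summit.HodgeConjecture.Ring2WeilCoverage.RealUnitNormHalfSystems (complexConj_eq_inv)
open Summit.HodgeConjecture.Ring2WeilCoverage.CyclotomicPrincipalObstruction (complexConj_xi)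
open Summit.HodgeConjecture.Ring2WeilCoverage.CyclotomicDifferent (isOfType_one_xi_top xi_ne_zero)
open Summit.HodgeConjecture.HodgeConjecture.Ring2.WeilCoverage (mk_neg_eq_split_of_odd mk_neg_ne_split_of_odd
  mk_eq_split_of_even mk_ne_split_of_even mem_normUnitsSubgroup_of_sq_add_mul_sq natCast_not_mem_normUnitsSubgroup_of_ramified)
open Summit.HodgeConjecture.HodgeConjecture.Ring2.Hypotheses (splitDiscriminantClass)
open Summit.HodgeConjecture.Ring2WeilCoverage.WeilGramLevel84
open Summit.HodgeConjecture.Ring2WeilCoverage.WeilGramLevel84SqrtNegOneGram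
open Summit.HodgeConjecture.Ring2WeilCoverage.WeilGramLevel84SqrtNegOne
open Summit.HodgeConjecture.Ring2WeilCoverage.WeilGramLevel84SqrtNegThreeGram
open Summit.HodgeConjecture.Ring2WeilCoverage.WeilGramLevel84SqrtNegThree
open Summit.HodgeConjecture.Ring2WeilCoverage.WeilGramLevel84SqrtNegSevenGram
open Summit.HodgeConjecture.Ring2WeilCoverage.WeilGramLevel84SqrtNegSeven
open Summit.HodgeConjecture.Ring2WeilCoverage.WeilGramLevel84SqrtNegTwentyOneGram
open Summit.HodgeConjecture.Ring2WeilCoverage.WeilGramLevel84SqrtNegTwentyOne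
open Summit.HodgeConjecture.Ring2WeilCoverage.WeilGramSign (not_pos_of_neg_one_pow_mul_det_nonpos neg_one_pow_mul_det_realPart_pos)
open Summit.HodgeConjecture.Ring2WeilCoverage.RealUnitNormTwelve (norm_realUnits_pos_eightyFour)
open Summit.HodgeConjecture.Ring2WeilCoverage.CyclotomicSignaturesG12 (exists_principal_eightyFour_sqrt_neg_one exists_principal_eightyFour_sqrt_neg_three exists_principal_eightyFour_sqrt_neg_seven exists_principal_eightyFour_sqrt_neg_twentyOne)
variable {K : Type} [Field K] [NumberField K] {ζ : K}

/-- `𝐞(t) = exp(2πi t/n) ∈ ℂ` (`ZMod.toCircle`). -/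
local notation3 (prettyPrint := false) "𝐞 " t:max => ((ZMod.toCircle t : Circle) : ℂ)

/-- the residue set `S_Φ` read at level `84`. -/
local notation3 (prettyPrint := false) "SΦ[" Φ "," z "]" =>
  (Finset.univ.filter fun t : ZMod 84 => ∃ σ ∈ (Φ : CMType K).1, σ (z : K) = 𝐞 t)

/-! ### §2 `1, θ, …, θ¹¹` is a `ℚ`-basis of `K⁺ = ℚ(ζ₈₄)⁺` -/

/-- `[ℚ(ζ_84)⁺ : ℚ] = 12`. [folklore] -/
theorem finrank_realSubfield [IsCyclotomicExtension {84} ℚ K] [IsCMField K] :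
    finrank ℚ (maximalRealSubfield K) = 12 := by
  have h1 : finrank ℚ K = 24 := by
    rw [IsCyclotomicExtension.finrank K (cyclotomic.irreducible_rat (by norm_num : 0 < 84))]; decide
  have h2 := Module.finrank_mul_finrank ℚ (maximalRealSubfield K) K
  rw [Algebra.IsQuadraticExtension.finrank_eq_two (maximalRealSubfield K) K, h1] at h2
  omega

/-- **`1, θ, …, θ^{12−1}` are `ℚ`-linearly independent in `K⁺`**: a relation `Σ cₖ θ^k = 0`, multiplied by `ζ′ s θ^m` and
traced, says that `c` is in the kernel of the Gram matrix `a` of §1, whose determinant is non-zero.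
research route conditional on HC_CM; not a corollary; Q11.4-sentence-2 already refuted in dim ≥ 3. [folklore] -/
theorem linearIndependent_thetaPow [IsCyclotomicExtension {84} ℚ K] [IsCMField K] (hζ : IsPrimitiveRoot ζ 84)
    {ω : Fin 12 → maximalRealSubfield K} (hω : ∀ i, (ω i : K) = (ζ + ζ⁻¹) ^ (i : ℕ)) : LinearIndependent ℚ ω := by
  rw [Fintype.linearIndependent_iff]
  intro c hc
  have hcK : ∑ i : Fin 12, (c i : K) * (ζ + ζ⁻¹) ^ (i : ℕ) = 0 := by
    have h := congrArg (fun y : maximalRealSubfield K => (y : K)) hc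
    simp only [ZeroMemClass.coe_zero] at h
    rw [← h]
    push_cast
    refine Finset.sum_congr rfl fun i _ => ?_
    rw [Rat.smul_def, hω i]
  have E : ∀ m : ℕ, ∑ i : Fin 12, c i * Algebra.trace ℚ K ((ζ ^ 11 * (aeval ζ (derivative (cyclotomic 84 ℚ)))⁻¹) * (ζ ^ 21) *
      ((ζ + ζ⁻¹) ^ m * (ζ + ζ⁻¹) ^ (i : ℕ))) = 0 := by
    intro m
    have h := congrArg (fun y => Algebra.trace ℚ K ((ζ ^ 11 * (aeval ζ (derivative (cyclotomic 84 ℚ)))⁻¹) * (ζ ^ 21) * (ζ + ζ⁻¹) ^ m * y)) hcK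
    simp only [mul_zero, map_zero, Finset.mul_sum, map_sum] at h
    rw [← h]
    refine Finset.sum_congr rfl fun i _ => ?_
    rw [show (ζ ^ 11 * (aeval ζ (derivative (cyclotomic 84 ℚ)))⁻¹) * (ζ ^ 21) * (ζ + ζ⁻¹) ^ m *
        ((c i : K) * (ζ + ζ⁻¹) ^ (i : ℕ)) = (c i) • ((ζ ^ 11 * (aeval ζ (derivative (cyclotomic 84 ℚ)))⁻¹) * (ζ ^ 21) *
        ((ζ + ζ⁻¹) ^ m * (ζ + ζ⁻¹) ^ (i : ℕ))) by rw [Rat.smul_def]; ring, map_smul, smul_eq_mul]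
  set x : Fin 12 → K := fun i => (ζ + ζ⁻¹) ^ (i : ℕ) with hxdef
  have hx : ∀ i, x i = (ζ + ζ⁻¹) ^ (i : ℕ) := fun i => rfl
  set a : Matrix (Fin 12) (Fin 12) ℚ := Matrix.of fun i j => Algebra.trace ℚ K ((ζ ^ 11 * (aeval ζ (derivative (cyclotomic 84 ℚ)))⁻¹) * x i *
      IsCMField.complexConj K ((ζ ^ 21) * x j)) with hadef
  have ha : ∀ i j, a i j = Algebra.trace ℚ K ((ζ ^ 11 * (aeval ζ (derivative (cyclotomic 84 ℚ)))⁻¹) * x i *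
      IsCMField.complexConj K ((ζ ^ 21) * x j)) := fun i j => rfl
  have hdet : a.det ≠ 0 := by
    rw [det_realPart_xi_sqrtNegOne hζ hx ha]; norm_num
  have ha2 : ∀ i j, a i j = -Algebra.trace ℚ K ((ζ ^ 11 * (aeval ζ (derivative (cyclotomic 84 ℚ)))⁻¹) * (ζ ^ 21) * (x i * x j)) :=
    fun i j => by
      have h := congrFun (congrFun (ha_eq (complexConj_sqrtNegOne hζ) (complexConj_thetaFrame hζ hx) ha) i) j
      rwa [Matrix.of_apply] at h
  have hmv : a.mulVec (fun i => c i) = 0 := by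
    funext m
    simp only [Matrix.mulVec, dotProduct, Pi.zero_apply, ha2, hx, neg_mul]
    rw [Finset.sum_neg_distrib, neg_eq_zero, ← E m]
    exact Finset.sum_congr rfl fun i _ => mul_comm _ _
  have h0 := Matrix.eq_zero_of_mulVec_eq_zero hdet hmv
  intro i
  simpa using congrFun h0 i

/-- **A `ℚ`-basis `ωb` of `K⁺ = ℚ(ζ_84)⁺` with `ωb i = θ^i`** (`i < 12`). [folklore] -/
theorem exists_basis_thetaPow [IsCyclotomicExtension {84} ℚ K] [IsCMField K] (hζ : IsPrimitiveRoot ζ 84) :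
    ∃ ωb : Basis (Fin 12) ℚ (maximalRealSubfield K), ∀ i, (ωb i : K) = (ζ + ζ⁻¹) ^ (i : ℕ) := by
  let θ' : maximalRealSubfield K :=
    ⟨ζ + ζ⁻¹, (IsCMField.complexConj_eq_self_iff K (ζ + ζ⁻¹)).mp (complexConj_theta hζ)⟩
  let ω : Fin 12 → maximalRealSubfield K := fun i => θ' ^ (i : ℕ)
  have hω : ∀ i, (ω i : K) = (ζ + ζ⁻¹) ^ (i : ℕ) := fun i => by simp [ω, θ']
  have hli := linearIndependent_thetaPow hζ hω
  have hcard : Fintype.card (Fin 12) = finrank ℚ (maximalRealSubfield K) := by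
    rw [Fintype.card_fin, finrank_realSubfield]
  exact ⟨basisOfLinearIndependentOfCardEqFinrank hli hcard, fun i => by
    rw [coe_basisOfLinearIndependentOfCardEqFinrank]; exact hω i⟩

/-! ### §3 `K_d = ℚ(i)` (`s = i`): invariance, census form, class SPLIT (row W12.1.1) -/

/-- **For EVERY skew `ζ′` of PRINCIPAL type on `ℤ[ζ_84]` (`IsOfType 1 ζ′ ⊤`; `ζ′ = uξ`, `u` a real unit, `N(u) = 1`
by THEOREM L (i) at `84`) the Gram determinant of `(E_ζ′, i)` in the frame `θ^i` (`i < 12`) is `4096`** (such `Φ`-positive `ζ′` exist on every `ℚ(i)`-balanced `Φ`, `exists_principal_eightyFour_sqrt_neg_one`): the SPLIT row for `ℚ(i)` at `g = 12` (census W12.1.1 `= (6, ℚ(i), 1)`);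
`(−1)⁶ det a > 0`, the right sign for Weil signature `(6,6)` [vG94 5.2 (4)].
research route conditional on HC_CM; not a corollary; Q11.4-sentence-2 already refuted in dim ≥ 3. [cite: vanGeemen1994HodgeAV, Lemma 5.2 (3)–(4) and (5.4.1)] [cite: Shimura1998, §14.3 Prop. 5, p. 104] -/
theorem det_realPart_principal_sqrtNegOne [IsCyclotomicExtension {84} ℚ K] [IsCMField K]
    (hζ : IsPrimitiveRoot ζ 84) {ζ' : K} (hζ' : IsCMField.complexConj K ζ' = -ζ')
    (hT : CMTypeLattice.IsOfType (1 : (FractionalIdeal (𝓞 K)⁰ K)ˣ) ζ' ⊤)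
    {x : Fin 12 → K} (hx : ∀ i, x i = (ζ + ζ⁻¹) ^ (i : ℕ)) {a : Matrix (Fin 12) (Fin 12) ℚ}
    (ha : ∀ i j, a i j = Algebra.trace ℚ K (ζ' * x i * IsCMField.complexConj K ((ζ ^ 21) * x j))) :
    a.det = 4096 := by
  obtain ⟨ωb, hωb⟩ := exists_basis_thetaPow hζ
  have hx' : ∀ i, x i = (ωb i : K) := fun i => (hx i).trans (hωb i).symm
  rw [det_realPart_eq_of_isOfType ωb (complexConj_sqrtNegOne hζ) hx' (norm_realUnits_pos_eightyFour hζ)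
    (complexConj_xi_eightyFour hζ) (xi_ne_zero hζ 11) hζ' (isOfType_one_xi_top hζ 11) hT (fun i j => rfl) ha]
  exact det_realPart_xi_sqrtNegOne hζ hx (fun i j => rfl)

open scoped Classical in
/-- **CENSUS FORM** (the YES row `(84, ℚ(√−1))`: existence in the tree + the determinant here): for every CM type `Φ` of
`ℚ(ζ_84)` balanced for `N_K = {11, 19, 23, 31, 43, 47, 55, 59, 67, 71, 79, 83}`, `ℂ^Φ/Φ(ℤ[ζ_84])` carries a `Φ`-positive divisor of PRINCIPAL type, and EVERY
such divisor has van Geemen Gram determinant `4096` in the real frame `θ^i`: the SPLIT row for `ℚ(i)` at `g = 12` (census W12.1.1 `= (6, ℚ(i), 1)`).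
research route conditional on HC_CM; not a corollary; Q11.4-sentence-2 already refuted in dim ≥ 3. [cite: vanGeemen1994HodgeAV, Lemma 5.2 (3)–(4) and (5.4.1)] [cite: Shimura1998, §14.3 Prop. 4–5, pp. 103–104] -/
theorem exists_principal_sqrtNegOne_det [IsCyclotomicExtension {84} ℚ K] [IsCMField K]
    (hζ : IsPrimitiveRoot ζ 84) (Φ : CMType K)
    (hbal : 2 * (SΦ[Φ, ζ] ∩ ({11, 19, 23, 31, 43, 47, 55, 59, 67, 71, 79, 83} : Finset (ZMod 84))).card = (SΦ[Φ, ζ]).card) :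
    ∃ ζ' : K, IsCMField.complexConj K ζ' = -ζ' ∧ (∀ φ : Φ.1, 0 < (φ.1 ζ').im) ∧
      CMTypeLattice.IsOfType (1 : (FractionalIdeal (𝓞 K)⁰ K)ˣ) ζ' ⊤ ∧
      ∀ (x : Fin 12 → K), (∀ i, x i = (ζ + ζ⁻¹) ^ (i : ℕ)) → ∀ a : Matrix (Fin 12) (Fin 12) ℚ,
        (∀ i j, a i j = Algebra.trace ℚ K (ζ' * x i * IsCMField.complexConj K ((ζ ^ 21) * x j))) →
        a.det = 4096 := by
  obtain ⟨ζ', h1, h2, h3⟩ := exists_principal_eightyFour_sqrt_neg_one hζ Φ hbal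
  exact ⟨ζ', h1, h2, h3, fun x hx a ha => det_realPart_principal_sqrtNegOne hζ h1 h3 hx ha⟩

/-- **`[4096]` is the SPLIT class `splitDiscriminantClass 6 1` in `ℚˣ/Nm(ℚ(√−1)ˣ)`** (`4096 = 64² + 1·0² ∈ Nm`; `n = 6` even):
the principally polarised Weil-type `ℤ[ζ₈₄]`-CM twelvefolds for `ℚ(i)` lie on the SPLIT row for `ℚ(i)` at `g = 12` (census W12.1.1 `= (6, ℚ(i), 1)`) — b02.1 (F3) / b01.8 for these CM points, in the kernel.
research route conditional on HC_CM; not a corollary; Q11.4-sentence-2 already refuted in dim ≥ 3. [cite: vanGeemen1994HodgeAV, 5.4 and (5.4.1)] -/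
theorem mk0_det_principal_sqrtNegOne :
    (QuotientGroup.mk (Units.mk0 (4096 : ℚ) (by norm_num)) : weilNormResidueGroup 1) = splitDiscriminantClass 6 1 :=
  mk_eq_split_of_even (by decide) (by norm_num : (4096 : ℚ) ≠ 0)
    (mem_normUnitsSubgroup_of_sq_add_mul_sq _ (64 : ℚ) (0 : ℚ) (by norm_num))

/-! ### §4 `K_d = ℚ(√−3)` (`s = s₃`): invariance, census form, class SPLIT (row W12.3.1) -/

/-- **For EVERY skew `ζ′` of PRINCIPAL type on `ℤ[ζ_84]` (`IsOfType 1 ζ′ ⊤`; `ζ′ = uξ`, `u` a real unit, `N(u) = 1`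
by THEOREM L (i) at `84`) the Gram determinant of `(E_ζ′, s₃)` in the frame `θ^i` (`i < 12`) is `2985984`** (such `Φ`-positive `ζ′` exist on every `ℚ(√−3)`-balanced `Φ`, `exists_principal_eightyFour_sqrt_neg_three`): the SPLIT row for `ℚ(√−3)` at `g = 12` (census W12.3.1 `= (6, ℚ(√−3), 1)`);
`(−1)⁶ det a > 0`, the right sign for Weil signature `(6,6)` [vG94 5.2 (4)].
research route conditional on HC_CM; not a corollary; Q11.4-sentence-2 already refuted in dim ≥ 3. [cite: vanGeemen1994HodgeAV, Lemma 5.2 (3)–(4) and (5.4.1)] [cite: Shimura1998, §14.3 Prop. 5, p. 104] -/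
theorem det_realPart_principal_sqrtNegThree [IsCyclotomicExtension {84} ℚ K] [IsCMField K]
    (hζ : IsPrimitiveRoot ζ 84) {ζ' : K} (hζ' : IsCMField.complexConj K ζ' = -ζ')
    (hT : CMTypeLattice.IsOfType (1 : (FractionalIdeal (𝓞 K)⁰ K)ˣ) ζ' ⊤)
    {x : Fin 12 → K} (hx : ∀ i, x i = (ζ + ζ⁻¹) ^ (i : ℕ)) {a : Matrix (Fin 12) (Fin 12) ℚ}
    (ha : ∀ i j, a i j = Algebra.trace ℚ K (ζ' * x i * IsCMField.complexConj K ((1 + 2 * ζ ^ 28) * x j))) :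
    a.det = 2985984 := by
  obtain ⟨ωb, hωb⟩ := exists_basis_thetaPow hζ
  have hx' : ∀ i, x i = (ωb i : K) := fun i => (hx i).trans (hωb i).symm
  rw [det_realPart_eq_of_isOfType ωb (complexConj_sqrtNegThree hζ) hx' (norm_realUnits_pos_eightyFour hζ)
    (complexConj_xi_eightyFour hζ) (xi_ne_zero hζ 11) hζ' (isOfType_one_xi_top hζ 11) hT (fun i j => rfl) ha]
  exact det_realPart_xi_sqrtNegThree hζ hx (fun i j => rfl)

open scoped Classical in
/-- **CENSUS FORM** (the YES row `(84, ℚ(√−3))`: existence in the tree + the determinant here): for every CM type `Φ` of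
`ℚ(ζ_84)` balanced for `N_K = {5, 11, 17, 23, 29, 41, 47, 53, 59, 65, 71, 83}`, `ℂ^Φ/Φ(ℤ[ζ_84])` carries a `Φ`-positive divisor of PRINCIPAL type, and EVERY
such divisor has van Geemen Gram determinant `2985984` in the real frame `θ^i`: the SPLIT row for `ℚ(√−3)` at `g = 12` (census W12.3.1 `= (6, ℚ(√−3), 1)`).
research route conditional on HC_CM; not a corollary; Q11.4-sentence-2 already refuted in dim ≥ 3. [cite: vanGeemen1994HodgeAV, Lemma 5.2 (3)–(4) and (5.4.1)] [cite: Shimura1998, §14.3 Prop. 4–5, pp. 103–104] -/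
theorem exists_principal_sqrtNegThree_det [IsCyclotomicExtension {84} ℚ K] [IsCMField K]
    (hζ : IsPrimitiveRoot ζ 84) (Φ : CMType K)
    (hbal : 2 * (SΦ[Φ, ζ] ∩ ({5, 11, 17, 23, 29, 41, 47, 53, 59, 65, 71, 83} : Finset (ZMod 84))).card = (SΦ[Φ, ζ]).card) :
    ∃ ζ' : K, IsCMField.complexConj K ζ' = -ζ' ∧ (∀ φ : Φ.1, 0 < (φ.1 ζ').im) ∧
      CMTypeLattice.IsOfType (1 : (FractionalIdeal (𝓞 K)⁰ K)ˣ) ζ' ⊤ ∧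
      ∀ (x : Fin 12 → K), (∀ i, x i = (ζ + ζ⁻¹) ^ (i : ℕ)) → ∀ a : Matrix (Fin 12) (Fin 12) ℚ,
        (∀ i j, a i j = Algebra.trace ℚ K (ζ' * x i * IsCMField.complexConj K ((1 + 2 * ζ ^ 28) * x j))) →
        a.det = 2985984 := by
  obtain ⟨ζ', h1, h2, h3⟩ := exists_principal_eightyFour_sqrt_neg_three hζ Φ hbal
  exact ⟨ζ', h1, h2, h3, fun x hx a ha => det_realPart_principal_sqrtNegThree hζ h1 h3 hx ha⟩

/-- **`[2985984]` is the SPLIT class `splitDiscriminantClass 6 3` in `ℚˣ/Nm(ℚ(√−3)ˣ)`** (`2985984 = 1728² + 3·0² ∈ Nm`; `n = 6` even):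
the principally polarised Weil-type `ℤ[ζ₈₄]`-CM twelvefolds for `ℚ(√−3)` lie on the SPLIT row for `ℚ(√−3)` at `g = 12` (census W12.3.1 `= (6, ℚ(√−3), 1)`) — b02.1 (F3) / b01.8 for these CM points, in the kernel.
research route conditional on HC_CM; not a corollary; Q11.4-sentence-2 already refuted in dim ≥ 3. [cite: vanGeemen1994HodgeAV, 5.4 and (5.4.1)] -/
theorem mk0_det_principal_sqrtNegThree :
    (QuotientGroup.mk (Units.mk0 (2985984 : ℚ) (by norm_num)) : weilNormResidueGroup 3) = splitDiscriminantClass 6 3 :=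
  mk_eq_split_of_even (by decide) (by norm_num : (2985984 : ℚ) ≠ 0)
    (mem_normUnitsSubgroup_of_sq_add_mul_sq _ (1728 : ℚ) (0 : ℚ) (by norm_num))

/-! ### §5 `K_d = ℚ(√−7)` (`s = s₇`): invariance, census form, class SPLIT (row W12.7.1) -/

/-- **For EVERY skew `ζ′` of PRINCIPAL type on `ℤ[ζ_84]` (`IsOfType 1 ζ′ ⊤`; `ζ′ = uξ`, `u` a real unit, `N(u) = 1`
by THEOREM L (i) at `84`) the Gram determinant of `(E_ζ′, s₇)` in the frame `θ^i` (`i < 12`) is `481890304`** (such `Φ`-positive `ζ′` exist on every `ℚ(√−7)`-balanced `Φ`, `exists_principal_eightyFour_sqrt_neg_seven`): the SPLIT row for `ℚ(√−7)` at `g = 12` (census W12.7.1 `= (6, ℚ(√−7), 1)`);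
`(−1)⁶ det a > 0`, the right sign for Weil signature `(6,6)` [vG94 5.2 (4)].
research route conditional on HC_CM; not a corollary; Q11.4-sentence-2 already refuted in dim ≥ 3. [cite: vanGeemen1994HodgeAV, Lemma 5.2 (3)–(4) and (5.4.1)] [cite: Shimura1998, §14.3 Prop. 5, p. 104] -/
theorem det_realPart_principal_sqrtNegSeven [IsCyclotomicExtension {84} ℚ K] [IsCMField K]
    (hζ : IsPrimitiveRoot ζ 84) {ζ' : K} (hζ' : IsCMField.complexConj K ζ' = -ζ')
    (hT : CMTypeLattice.IsOfType (1 : (FractionalIdeal (𝓞 K)⁰ K)ˣ) ζ' ⊤)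
    {x : Fin 12 → K} (hx : ∀ i, x i = (ζ + ζ⁻¹) ^ (i : ℕ)) {a : Matrix (Fin 12) (Fin 12) ℚ}
    (ha : ∀ i j, a i j = Algebra.trace ℚ K (ζ' * x i * IsCMField.complexConj K ((1 + 2 * (ζ ^ 12 + ζ ^ 24 + ζ ^ 48)) * x j))) :
    a.det = 481890304 := by
  obtain ⟨ωb, hωb⟩ := exists_basis_thetaPow hζ
  have hx' : ∀ i, x i = (ωb i : K) := fun i => (hx i).trans (hωb i).symm
  rw [det_realPart_eq_of_isOfType ωb (complexConj_sqrtNegSeven hζ) hx' (norm_realUnits_pos_eightyFour hζ)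
    (complexConj_xi_eightyFour hζ) (xi_ne_zero hζ 11) hζ' (isOfType_one_xi_top hζ 11) hT (fun i j => rfl) ha]
  exact det_realPart_xi_sqrtNegSeven hζ hx (fun i j => rfl)

open scoped Classical in
/-- **CENSUS FORM** (the YES row `(84, ℚ(√−7))`: existence in the tree + the determinant here): for every CM type `Φ` of
`ℚ(ζ_84)` balanced for `N_K = {5, 13, 17, 19, 31, 41, 47, 55, 59, 61, 73, 83}`, `ℂ^Φ/Φ(ℤ[ζ_84])` carries a `Φ`-positive divisor of PRINCIPAL type, and EVERY
such divisor has van Geemen Gram determinant `481890304` in the real frame `θ^i`: the SPLIT row for `ℚ(√−7)` at `g = 12` (census W12.7.1 `= (6, ℚ(√−7), 1)`).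
research route conditional on HC_CM; not a corollary; Q11.4-sentence-2 already refuted in dim ≥ 3. [cite: vanGeemen1994HodgeAV, Lemma 5.2 (3)–(4) and (5.4.1)] [cite: Shimura1998, §14.3 Prop. 4–5, pp. 103–104] -/
theorem exists_principal_sqrtNegSeven_det [IsCyclotomicExtension {84} ℚ K] [IsCMField K]
    (hζ : IsPrimitiveRoot ζ 84) (Φ : CMType K)
    (hbal : 2 * (SΦ[Φ, ζ] ∩ ({5, 13, 17, 19, 31, 41, 47, 55, 59, 61, 73, 83} : Finset (ZMod 84))).card = (SΦ[Φ, ζ]).card) :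
    ∃ ζ' : K, IsCMField.complexConj K ζ' = -ζ' ∧ (∀ φ : Φ.1, 0 < (φ.1 ζ').im) ∧
      CMTypeLattice.IsOfType (1 : (FractionalIdeal (𝓞 K)⁰ K)ˣ) ζ' ⊤ ∧
      ∀ (x : Fin 12 → K), (∀ i, x i = (ζ + ζ⁻¹) ^ (i : ℕ)) → ∀ a : Matrix (Fin 12) (Fin 12) ℚ,
        (∀ i j, a i j = Algebra.trace ℚ K (ζ' * x i * IsCMField.complexConj K ((1 + 2 * (ζ ^ 12 + ζ ^ 24 + ζ ^ 48)) * x j))) →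
        a.det = 481890304 := by
  obtain ⟨ζ', h1, h2, h3⟩ := exists_principal_eightyFour_sqrt_neg_seven hζ Φ hbal
  exact ⟨ζ', h1, h2, h3, fun x hx a ha => det_realPart_principal_sqrtNegSeven hζ h1 h3 hx ha⟩

/-- **`[481890304]` is the SPLIT class `splitDiscriminantClass 6 7` in `ℚˣ/Nm(ℚ(√−7)ˣ)`** (`481890304 = 21952² + 7·0² ∈ Nm`; `n = 6` even):
the principally polarised Weil-type `ℤ[ζ₈₄]`-CM twelvefolds for `ℚ(√−7)` lie on the SPLIT row for `ℚ(√−7)` at `g = 12` (census W12.7.1 `= (6, ℚ(√−7), 1)`) — b02.1 (F3) / b01.8 for these CM points, in the kernel.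
research route conditional on HC_CM; not a corollary; Q11.4-sentence-2 already refuted in dim ≥ 3. [cite: vanGeemen1994HodgeAV, 5.4 and (5.4.1)] -/
theorem mk0_det_principal_sqrtNegSeven :
    (QuotientGroup.mk (Units.mk0 (481890304 : ℚ) (by norm_num)) : weilNormResidueGroup 7) = splitDiscriminantClass 6 7 :=
  mk_eq_split_of_even (by decide) (by norm_num : (481890304 : ℚ) ≠ 0)
    (mem_normUnitsSubgroup_of_sq_add_mul_sq _ (21952 : ℚ) (0 : ℚ) (by norm_num))

/-! ### §6 `K_d = ℚ(√−21)` (`s = s₂₁`): invariance, census form, class SPLIT (row W12.21.1) -/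

/-- **For EVERY skew `ζ′` of PRINCIPAL type on `ℤ[ζ_84]` (`IsOfType 1 ζ′ ⊤`; `ζ′ = uξ`, `u` a real unit, `N(u) = 1`
by THEOREM L (i) at `84`) the Gram determinant of `(E_ζ′, s₂₁)` in the frame `θ^i` (`i < 12`) is `351298031616`** (such `Φ`-positive `ζ′` exist on every `ℚ(√−21)`-balanced `Φ`, `exists_principal_eightyFour_sqrt_neg_twentyOne`): the SPLIT row for `ℚ(√−21)` at `g = 12` (census W12.21.1 `= (6, ℚ(√−21), 1)`);
`(−1)⁶ det a > 0`, the right sign for Weil signature `(6,6)` [vG94 5.2 (4)].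
research route conditional on HC_CM; not a corollary; Q11.4-sentence-2 already refuted in dim ≥ 3. [cite: vanGeemen1994HodgeAV, Lemma 5.2 (3)–(4) and (5.4.1)] [cite: Shimura1998, §14.3 Prop. 5, p. 104] -/
theorem det_realPart_principal_sqrtNegTwentyOne [IsCyclotomicExtension {84} ℚ K] [IsCMField K]
    (hζ : IsPrimitiveRoot ζ 84) {ζ' : K} (hζ' : IsCMField.complexConj K ζ' = -ζ')
    (hT : CMTypeLattice.IsOfType (1 : (FractionalIdeal (𝓞 K)⁰ K)ˣ) ζ' ⊤)
    {x : Fin 12 → K} (hx : ∀ i, x i = (ζ + ζ⁻¹) ^ (i : ℕ)) {a : Matrix (Fin 12) (Fin 12) ℚ}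
    (ha : ∀ i j, a i j = Algebra.trace ℚ K (ζ' * x i * IsCMField.complexConj K ((ζ ^ 21 * (1 + 2 * ζ ^ 28) * (1 + 2 * (ζ ^ 12 + ζ ^ 24 + ζ ^ 48))) * x j))) :
    a.det = 351298031616 := by
  obtain ⟨ωb, hωb⟩ := exists_basis_thetaPow hζ
  have hx' : ∀ i, x i = (ωb i : K) := fun i => (hx i).trans (hωb i).symm
  rw [det_realPart_eq_of_isOfType ωb (complexConj_sqrtNegTwentyOne hζ) hx' (norm_realUnits_pos_eightyFour hζ)
    (complexConj_xi_eightyFour hζ) (xi_ne_zero hζ 11) hζ' (isOfType_one_xi_top hζ 11) hT (fun i j => rfl) ha]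
  exact det_realPart_xi_sqrtNegTwentyOne hζ hx (fun i j => rfl)

open scoped Classical in
/-- **CENSUS FORM** (the YES row `(84, ℚ(√−21))`: existence in the tree + the determinant here): for every CM type `Φ` of
`ℚ(ζ_84)` balanced for `N_K = {13, 29, 43, 47, 53, 59, 61, 65, 67, 73, 79, 83}`, `ℂ^Φ/Φ(ℤ[ζ_84])` carries a `Φ`-positive divisor of PRINCIPAL type, and EVERY
such divisor has van Geemen Gram determinant `351298031616` in the real frame `θ^i`: the SPLIT row for `ℚ(√−21)` at `g = 12` (census W12.21.1 `= (6, ℚ(√−21), 1)`).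
research route conditional on HC_CM; not a corollary; Q11.4-sentence-2 already refuted in dim ≥ 3. [cite: vanGeemen1994HodgeAV, Lemma 5.2 (3)–(4) and (5.4.1)] [cite: Shimura1998, §14.3 Prop. 4–5, pp. 103–104] -/
theorem exists_principal_sqrtNegTwentyOne_det [IsCyclotomicExtension {84} ℚ K] [IsCMField K]
    (hζ : IsPrimitiveRoot ζ 84) (Φ : CMType K)
    (hbal : 2 * (SΦ[Φ, ζ] ∩ ({13, 29, 43, 47, 53, 59, 61, 65, 67, 73, 79, 83} : Finset (ZMod 84))).card = (SΦ[Φ, ζ]).card) :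
    ∃ ζ' : K, IsCMField.complexConj K ζ' = -ζ' ∧ (∀ φ : Φ.1, 0 < (φ.1 ζ').im) ∧
      CMTypeLattice.IsOfType (1 : (FractionalIdeal (𝓞 K)⁰ K)ˣ) ζ' ⊤ ∧
      ∀ (x : Fin 12 → K), (∀ i, x i = (ζ + ζ⁻¹) ^ (i : ℕ)) → ∀ a : Matrix (Fin 12) (Fin 12) ℚ,
        (∀ i j, a i j = Algebra.trace ℚ K (ζ' * x i * IsCMField.complexConj K ((ζ ^ 21 * (1 + 2 * ζ ^ 28) * (1 + 2 * (ζ ^ 12 + ζ ^ 24 + ζ ^ 48))) * x j))) →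
        a.det = 351298031616 := by
  obtain ⟨ζ', h1, h2, h3⟩ := exists_principal_eightyFour_sqrt_neg_twentyOne hζ Φ hbal
  exact ⟨ζ', h1, h2, h3, fun x hx a ha => det_realPart_principal_sqrtNegTwentyOne hζ h1 h3 hx ha⟩

/-- **`[351298031616]` is the SPLIT class `splitDiscriminantClass 6 21` in `ℚˣ/Nm(ℚ(√−21)ˣ)`** (`351298031616 = 592704² + 21·0² ∈ Nm`; `n = 6` even):
the principally polarised Weil-type `ℤ[ζ₈₄]`-CM twelvefolds for `ℚ(√−21)` lie on the SPLIT row for `ℚ(√−21)` at `g = 12` (census W12.21.1 `= (6, ℚ(√−21), 1)`) — b02.1 (F3) / b01.8 for these CM points, in the kernel.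
research route conditional on HC_CM; not a corollary; Q11.4-sentence-2 already refuted in dim ≥ 3. [cite: vanGeemen1994HodgeAV, 5.4 and (5.4.1)] -/
theorem mk0_det_principal_sqrtNegTwentyOne :
    (QuotientGroup.mk (Units.mk0 (351298031616 : ℚ) (by norm_num)) : weilNormResidueGroup 21) = splitDiscriminantClass 6 21 :=
  mk_eq_split_of_even (by decide) (by norm_num : (351298031616 : ℚ) ≠ 0)
    (mem_normUnitsSubgroup_of_sq_add_mul_sq _ (592704 : ℚ) (0 : ℚ) (by norm_num))

end Summit.HodgeConjecture.Ring2WeilCoverage.WeilGramLevel84Principal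

end
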